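import Summits.CriticalPhenomena.PercolationContinuityZ3.Theorems.Transplant.PlanarCells2Levels
import Summits.CriticalPhenomena.PercolationContinuityZ3.Theorems.Transplant.PlanarSkeletonPrisms
import HarnessLib

/-!
# Two-unit planar cells `PCells2` (layer L1′ of route D″ v2), part 6: the planar supplement of the (F) face residue — the shrunk far rows
# `farAS` against the cube, their 1-thickening inside `EfarN`, their levels, and the (enlarged) shifted face row inside `farAS`

builds on p205010 (kernel theorem, internal audit signed; external expert review pending) — nothing in this file uses p205010.
Lane `prim-bschramm`, seat `prim-hp-8` (gen 28; `HOME/bschramm/DPRIME-SCOPE.md` §2 L1′/L6′ + addendum E, lead VERDICT V98); helper file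
(`--supports stmt-CriticalPhenomena-4575 --as helper`).  The pure-`Site 2` §1 of `SkelConcFaceRegion` (the (F) residue of the general node, hp-8 gen 24)
re-typed over `PCells2`: levels in the unit `r∥ = r (du.1)`, transverse widths in `r⊥ = r (oth du.1)`.  The window-level §2 of that file
(`Win_farAS_subset_Efar`, `M_subset_Win_farAS`, …) needs the point-free window API (`SkelNPrisms`, p3 lineage) and the two-unit radii record
(p2 lineage) and is NOT re-issued here.
* `mem_EfarN_of_near_farAS` (the planar 1-thickening of `farAS` lies in `EfarN`), `le_lev_of_mem_farAS` (`≥ 5r∥ + 2`), `lev_le_of_mem_farAS`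
  (`≤ 25r∥ − 1`), **`Q_sepInf_farAS`** (gap 2 along the axis), `Q_sep_farAS`, `mem_faceRow_of_mem_Stub`, `lev_eq_faceL_of_mem_faceRow`,
  `faceRow_subset_Stub_succ` (the shifted row lies in `H^{j+1}`, `10 s∥ ≥ 1`), `faceRow_subset_Hfull`;
* **`faceRow_enlarge_subset_farAS`** — the `k`-enlarged shifted face row lies in `farAS x du j` when `j + 1 ≤ K`, `k + 3 ≤ 10 s∥` AND
  `k + 2 ≤ 3 r⊥` (two units: the transverse room `2r⊥ + k ≤ 5r⊥ − 2` is a separate hypothesis; with one unit it followed from `k ≤ 10s − 3`).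
[cite: KozmaNitzan2024, §4 p. 26 ((29)), p. 30 (the rows above H^j, F^{j+1}) — the ℤ^d model, one unit]
-/

noncomputable section

namespace Summit.CriticalPhenomena.PercolationContinuityZ3.Theorems

namespace Transplant

open Literature.Probability.Percolation Literature.Probability.LatticeModels SimpleGraph GadgetSystem Contour
open Literature.Probability.Percolation.KozmaNitzan
open Literature.Probability.Percolation.KozmaNitzan.Cells (oth oth_ne sgOf sgOf_sign stepVec_apply_fst stepVec_apply_oth eq_oth_of_ne oth_oth
  eq_of_coords)
open PlanarSkeleton (SepInf)
open PCells (mem_psBox_iff sepZ2_of_sepInf)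

namespace PCells2

variable (P : PCells2)

/-! ## The shrunk far rows -/

/-- **The planar 1-thickening of `farAS` lies in `EfarN`.** [folklore] -/
theorem mem_EfarN_of_near_farAS {x : Site 2} {du : MDir} {j : ℕ} {t t' : Site 2} (ht : t ∈ P.farAS x du j)
    (h : ∀ i, |t' i - t i| ≤ 1) : t' ∈ P.EfarN x du := by
  rw [farAS, mem_psBox_iff] at ht
  rw [EfarN, mem_psBox_iff]
  have h1 := abs_le.1 (h du.1)
  have h2 := abs_le.1 (h (oth du.1))
  have hr := P.one_le_r (oth du.1)
  refine ⟨?_, by omega⟩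
  rcases sgOf_sign du with hs | hs <;> rw [hs] at ht ⊢ <;> constructor <;> nlinarith [ht.1.1, ht.1.2, Nat.zero_le j, P.hs du.1]

/-- Points of `farAS` have level `≥ 5r∥ + 10 s∥ j + 2 ≥ 5r∥ + 2`. [folklore] -/
theorem le_lev_of_mem_farAS {x : Site 2} {du : MDir} {j : ℕ} {t : Site 2} (ht : t ∈ P.farAS x du j) :
    5 * (P.r du.1 : ℤ) + 2 ≤ P.lev du x t := by
  rw [farAS, mem_psBox_iff] at ht
  unfold PCells2.lev
  nlinarith [ht.1.1, Nat.zero_le j, P.hs du.1]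

/-- Points of `farAS x du j` have level `≥ 5r∥ + 10 s∥ j + 2` (the sharp lower level). [folklore] -/
theorem le_lev_of_mem_farAS' {x : Site 2} {du : MDir} {j : ℕ} {t : Site 2} (ht : t ∈ P.farAS x du j) :
    5 * (P.r du.1 : ℤ) + 10 * P.s du.1 * j + 2 ≤ P.lev du x t := by
  rw [farAS, mem_psBox_iff] at ht; exact ht.1.1

/-- Points of `farAS` have level `≤ 25r∥ − 1`. [folklore] -/
theorem lev_le_of_mem_farAS {x : Site 2} {du : MDir} {j : ℕ} {t : Site 2} (ht : t ∈ P.farAS x du j) :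
    P.lev du x t ≤ 25 * P.r du.1 - 1 := by
  rw [farAS, mem_psBox_iff] at ht; exact ht.1.2

/-- **The cube `Q_x` and `farAS x du j` are ℓ^∞-gap separated** (levels `≤ 5r∥` against `≥ 5r∥ + 2`). [cite: KozmaNitzan2024, §4 p. 26 ((29))] -/
theorem Q_sepInf_farAS (x : Site 2) (du : MDir) (j : ℕ) : SepInf (↑(P.Q x) : Set (Site 2)) ↑(P.farAS x du j) := by
  intro y hy z hz
  have h1 : P.lev du x y ≤ 5 * P.r du.1 := P.lev_le_of_mem_Q (Finset.mem_coe.1 hy)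
  have h2 := P.le_lev_of_mem_farAS (Finset.mem_coe.1 hz)
  refine ⟨du.1, ?_⟩
  unfold PCells2.lev at h1 h2
  rw [le_abs]
  rcases sgOf_sign du with hs | hs <;> rw [hs] at h1 h2
  · right; linarith
  · left; linarith

/-- `ℤ²` form: the cube `Q_x` and `farAS x du j` are separated (no common vertex, no `ℤ²`-edge). [cite: KozmaNitzan2024, §4 p. 26 ((29))] -/
theorem Q_sep_farAS (x : Site 2) (du : MDir) (j : ℕ) : KozmaNitzan.Sep (↑(P.Q x) : Set (Site 2)) ↑(P.farAS x du j) :=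
  sepZ2_of_sepInf (P.Q_sepInf_farAS x du j)

/-- The stub of level `j` and `farAS x du j` are ℓ^∞-gap separated (levels `≤ 5r∥ + 10s∥j` against `≥ 5r∥ + 10s∥j + 2`). [folklore] -/
theorem Stub_sepInf_farAS (x : Site 2) (du : MDir) (j : ℕ) : SepInf (↑(P.Stub x du j) : Set (Site 2)) ↑(P.farAS x du j) := by
  intro y hy z hz
  have h1 := (P.lev_mem_of_mem_Stub (Finset.mem_coe.1 hy)).2
  have h2 := P.le_lev_of_mem_farAS' (Finset.mem_coe.1 hz)
  refine ⟨du.1, ?_⟩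
  unfold PCells2.lev at h1 h2
  rw [le_abs]
  rcases sgOf_sign du with hs | hs <;> rw [hs] at h1 h2
  · right; linarith
  · left; linarith

/-! ## The shifted face row -/

/-- A stub point at planar level `faceL j` lies in the shifted face row. [folklore] -/
theorem mem_faceRow_of_mem_Stub {x : Site 2} {du : MDir} {j j' : ℕ} {t : Site 2} (ht : t ∈ P.Stub x du j') (hl : P.lev du x t = P.faceL du.1 j) :
    t ∈ Finset.Icc (P.faceLo x du j) (P.faceHi x du j) := by
  rw [Stub, mem_psBox_iff] at ht
  rw [Icc_faceLo_faceHi, mem_psBox_iff]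
  unfold PCells2.lev at hl
  exact ⟨⟨le_of_eq hl.symm, le_of_eq hl⟩, ht.2⟩

/-- Points of the shifted face row have level exactly `faceL j`. [folklore] -/
theorem lev_eq_faceL_of_mem_faceRow {x : Site 2} {du : MDir} {j : ℕ} {t : Site 2} (ht : t ∈ Finset.Icc (P.faceLo x du j) (P.faceHi x du j)) :
    P.lev du x t = P.faceL du.1 j := by
  rw [Icc_faceLo_faceHi, mem_psBox_iff] at ht
  unfold PCells2.lev
  exact le_antisymm ht.1.2 ht.1.1

/-- The level of the shifted face row, unfolded: `faceL a j = 5r_a + 10 s_a (j+1) − 1`. [folklore] -/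
theorem faceL_eq (a : Fin 2) (j : ℕ) : P.faceL a j = 5 * (P.r a : ℤ) + 10 * (P.s a : ℤ) * (j + 1) - 1 := by
  unfold faceL; push_cast; ring

/-- The shifted face row lies in the stub `H^{j+1}` (`faceL j = 5r∥ + 10s∥(j+1) − 1`, and `10 s∥ (j+1) ≥ 1`). [folklore] -/
theorem faceRow_subset_Stub_succ (x : Site 2) (du : MDir) (j : ℕ) :
    Finset.Icc (P.faceLo x du j) (P.faceHi x du j) ⊆ P.Stub x du (j + 1) := by
  rw [Icc_faceLo_faceHi, Stub]
  have h := P.faceL_eq du.1 j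
  have hs1 : (1 : ℤ) ≤ P.s du.1 := by exact_mod_cast P.hs du.1
  refine sBox_mono (sgOf_sign du) _ ?_ ?_ le_rfl
  · rw [h]; nlinarith
  · rw [h]; push_cast; nlinarith

/-- The shifted face row lies in the full corridor when `j + 1 ≤ K`. [folklore] -/
theorem faceRow_subset_Hfull (x : Site 2) (du : MDir) {j : ℕ} (hj : j + 1 ≤ P.K) :
    Finset.Icc (P.faceLo x du j) (P.faceHi x du j) ⊆ P.Hfull x du :=
  (P.faceRow_subset_Stub_succ x du j).trans (P.Stub_subset_Hfull x du hj)

/-- **The `k`-enlargement of the shifted face row lies in `farAS x du j`** when `j + 1 ≤ K`, `k + 3 ≤ 10 s∥` (along the axis: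
`10 s∥ − 1 − k ≥ 2` below and `≤ 15 r∥ − 1 + k ≤ 25 r∥ − 1` above) and `k + 2 ≤ 3 r⊥` (transversally `2r⊥ + k ≤ 5r⊥ − 2`; with one unit this
followed from `k ≤ 10 s − 3 ≤ r/2 − 3`, with two units it is a separate hypothesis). [cite: KozmaNitzan2024, §4 p. 30 (the levels above F^{j+1})] -/
theorem faceRow_enlarge_subset_farAS (x : Site 2) (du : MDir) {j k : ℕ} (hj : j + 1 ≤ P.K) (hk : k + 3 ≤ 10 * P.s du.1)
    (hk' : k + 2 ≤ 3 * P.r (oth du.1)) :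
    Finset.Icc (P.faceLo x du j - (k : Site 2)) (P.faceHi x du j + (k : Site 2)) ⊆ P.farAS x du j := by
  rw [faceLo, faceHi, sBox_enlarge _ _ (sgOf_sign du), farAS]
  have hsj : (P.s du.1 : ℤ) * (j + 1) ≤ P.r du.1 := by
    have h := Nat.mul_le_mul_left (P.s du.1) hj
    rw [Nat.mul_comm (P.s du.1) P.K] at h
    exact_mod_cast (show P.s du.1 * (j + 1) ≤ P.r du.1 from h)
  have h20 := P.twenty_mul_s_le_r du.1
  have hkz : (k : ℤ) + 3 ≤ 10 * P.s du.1 := by exact_mod_cast hk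
  have hkz' : (k : ℤ) + 2 ≤ 3 * P.r (oth du.1) := by exact_mod_cast hk'
  unfold faceL
  refine sBox_mono (sgOf_sign du) _ ?_ ?_ ?_ <;> push_cast <;> nlinarith [P.one_le_r du.1, P.hs du.1]

end PCells2

end Transplant

end Summit.CriticalPhenomena.PercolationContinuityZ3.Theorems

end
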